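import Literature.AlgebraicGeometry.HodgeTheory.QuaternionicQuarticGenericModel
import HarnessLib

/-!
# The generic smooth projective `Q₈`-model from equivariant resolution OF SURFACES (programme «M1», brick M1-4a re-keyed)

Layer `Literature/AlgebraicGeometry/HodgeTheory`. Theorems only (no named fact, no definition). Route
`HodgeConjecture/Q8SymplecticPowers` (crux K1Q, stmt-HodgeConjecture-24190), brick M1-4a of programme M1:
`Q8Family.exists_genericModel` (`QuaternionicQuarticGenericModel.lean`, prover-Bx g19) produces the smooth projective
`Q₈`-model of the generic étale chart GIVEN the named fact `Resolution.Kollar2007_resolutionLiftsAutomorphisms`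
(Kollár 2007 Thm. 3.36 + §3.4.1, ALL dimensions, all automorphisms). Its proof consumes that fact at ONE scheme:
the equivariant projective completion `N` of the chart (de Jong 1996, 4.17), an integral projective SURFACE over
`K = Frac ℂ[a]` with a `Q₈`-action. This file re-keys the brick on exactly that:

* `exists_genericModel_of_surfaceLifting` — the conclusion of `exists_genericModel`, from the hypothesis
  «every integral projective `K`-scheme of dimension `2` with a `Q₈`-action over `K` has a resolution, projective
  over `K`, which is an isomorphism over the regular locus and to which the action lifts equivariantly» (the
  conclusion of `Kollar2007_resolutionLiftsAutomorphisms.exists_actionOver` at surfaces; same proof as the brick,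
  with the dimension count moved before the resolution step);
(The named fact implies the surface hypothesis — `Kollar2007_resolutionLiftsAutomorphisms.exists_actionOver` — so this
theorem specialises to `exists_genericModel`.)

The surface hypothesis is what the minimal-resolution route discharges
(`Resolution/MinimalResolutionLiftsAutomorphisms.lean`, `…/MinimalResolutionIsoOverRegularLocus.lean`,
`…/ProjectiveResolutionIsoOverRegularLocus.lean`: the conclusion of Kollár's fact holds at every integral
projective variety admitting a minimal resolution with projective source — Bădescu 2001 Thm. 4.3 ∕ Prop. 4.5 for
normal surfaces, not yet in the tree).

Honest scope: a re-keying of one conditional brick; nothing here bears on HC.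

## References

* [Kollar2007] J. Kollár, Lectures on Resolution of Singularities (2007), Thm. 3.36, §3.4.1 (p. 121).
* [DeJong1996] A. J. de Jong, Smoothness, semi-stability and alterations (1996), 4.17.
* [Badescu2001] L. Bădescu, Algebraic Surfaces (2001), Thm. 4.3, Prop. 4.5.
-/

noncomputable section

open CategoryTheory CategoryTheory.Limits AlgebraicGeometry TopologicalSpace

namespace Literature.AlgebraicGeometry.HodgeTheory.Q8Family

open Literature.AlgebraicGeometry.Motives Literature.AlgebraicGeometry.RelativeSpec
  Literature.AlgebraicGeometry.Resolution

variable (e : ℕ)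

/-- **The generic smooth projective `Q₈`-model, from equivariant resolution of `Q₈`-surfaces over `K`.** Let
`K = Frac ℂ[a]`. IF every integral projective `K`-scheme `N` of (topological Krull) dimension `2` with an action of
`Q₈` over `K` has a resolution `r : Y → N` with `Y` projective over `K`, `r` an isomorphism over every open of regular
points, and a lifted action for which `r` is equivariant, THEN there is a smooth projective geometrically irreducible
`K`-surface `E` with a `Q₈`-action and a `Q₈`-equivariant open immersion of the generic étale chart
`genericChart e K ↪ E` over `K` (`e ≥ 2`). Proof = the proof of `exists_genericModel` (equivariant projective
completion `N ⊇ U` by normalisation, de Jong 4.17; `dim N = dim U = 2`; resolve `N` equivariantly by the hypothesis;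
lift `U ↪ N` over the regular open `U`). [cite: Kollar2007, Thm. 3.36 and §3.4.1 (p. 121)] [cite: DeJong1996, 4.17, p. 72] -/
theorem exists_genericModel_of_surfaceLifting (he : 2 ≤ e)
    (H : ∀ (N : SchemeOver (FractionRing (ParamRing e))) [IsIntegral N.left], IsProjectiveOver N →
      topologicalKrullDim N.left = (2 : ℕ) → ∀ ρN : ActionOver N.hom (QuaternionGroup 2),
      ∃ (Y : Scheme) (r : Y ⟶ N.left) (ρY : ActionOver (r ≫ N.hom) (QuaternionGroup 2)), IsResolution r ∧
        IsProjectiveOver (Over.mk (r ≫ N.hom)) ∧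
        (∀ V : N.left.Opens, (∀ x ∈ V, IsRegularLocalRing (N.left.presheaf.stalk x)) → IsIso (r ∣_ V)) ∧
        ∀ g : QuaternionGroup 2, (ρY.aut g).hom ≫ r = r ≫ (ρN.aut g).hom) :
    ∃ (E : SchemeOver (FractionRing (ParamRing e))) (ρE : ActionOver E.hom (QuaternionGroup 2))
      (θ : genericChart e (FractionRing (ParamRing e)) ⟶ E),
      IsSmoothProjective 2 E ∧ IsOpenImmersion θ.left ∧
      ∀ g : QuaternionGroup 2,
        ((genericAction e (FractionRing (ParamRing e))).aut g).hom ≫ θ.left = θ.left ≫ (ρE.aut g).hom := by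
  set K : Type := FractionRing (ParamRing e) with hK
  haveI : CharZero K := charZero_of_injective_algebraMap (IsFractionRing.injective (ParamRing e) K)
  let U : SchemeOver K := genericChart e K
  let ρU : ActionOver U.hom (QuaternionGroup 2) := genericAction e K
  haveI : IsAffine U.left := isAffine_genericChart e K
  haveI : IsIntegral U.left := isIntegral_genericChart e K he
  haveI : LocallyOfFiniteType U.hom := locallyOfFiniteType_genericChart e K
  haveI : SmoothOfRelativeDimension 2 U.hom := smoothOfRelativeDimension_genericChart e K
  haveI : GeometricallyIrreducible U.hom := geometricallyIrreducible_genericChart e K he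
  have hUreg : Scheme.IsRegular U.left := isRegular_genericChart e K
  -- ### (1) equivariant projective completion `ι : U ↪ N`
  obtain ⟨N, ρN, ι, hNint, hNproj, hιopen, hιeq⟩ := exists_equivariant_projective_completion U ρU
  haveI := hNint
  haveI := hιopen
  haveI : IsProper N.hom := IsProjectiveOver.isProper hNproj
  haveI : IsLocallyNoetherian N.left := LocallyOfFiniteType.isLocallyNoetherian N.hom
  let V : N.left.Opens := ι.left.opensRange
  -- `N` is geometrically irreducible: `U ≅ V` is a dense open
  have hUV : U.hom = (ι.left.isoOpensRange.hom ≫ V.ι) ≫ N.hom := by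
    rw [Scheme.Hom.isoOpensRange_hom_ι, Over.w ι]
  haveI : GeometricallyIrreducible (V.ι ≫ N.hom) := by
    have hgi : GeometricallyIrreducible ((ι.left.isoOpensRange.hom ≫ V.ι) ≫ N.hom) := by rw [← hUV]; infer_instance
    rw [Category.assoc] at hgi
    exact (MorphismProperty.cancel_left_of_respectsIso @GeometricallyIrreducible _ _).mp hgi
  have hVdense : Dense (V : Set N.left) := by
    obtain ⟨u⟩ := (inferInstance : Nonempty U.left)
    exact V.2.dense ⟨ι.left u, ⟨u, rfl⟩⟩
  haveI : GeometricallyIrreducible N.hom := geometricallyIrreducible_of_dense_opens N.hom V hVdense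
  -- `dim N = dim U = 2`
  have hdimU : topologicalKrullDim U.left = (2 : ℕ) := topologicalKrullDim_eq_of_smoothOfRelativeDimension U.hom 2
  have hdimUN : topologicalKrullDim U.left = topologicalKrullDim N.left :=
    topologicalKrullDim_eq_of_isOpenImmersion N.hom ι.left
  have hdimN : topologicalKrullDim N.left = (2 : ℕ) := hdimUN.symm.trans hdimU
  -- ### (2) the equivariant resolution of the SURFACE `N` (hypothesis)
  obtain ⟨Y, r, ρY, hr, hYproj, hreg, hYeq⟩ := H N hNproj hdimN ρN
  let E : SchemeOver K := Over.mk (r ≫ N.hom)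
  haveI : IsProper E.hom := IsProjectiveOver.isProper hYproj
  haveI : IsProper (r ≫ N.hom) := inferInstanceAs (IsProper E.hom)
  haveI : Smooth (r ≫ N.hom) := smooth_of_isRegular_of_perfectField _ hr.isRegular
  have hgiY : GeometricallyIrreducible (r ≫ N.hom) := geometricallyIrreducible_of_isResolution N.hom hr
  haveI : IrreducibleSpace Y := hr.isBirational.irreducibleSpace
  obtain ⟨d, hd⟩ := exists_smoothOfRelativeDimension_of_smooth (r ≫ N.hom)
  haveI := hd
  -- `dim Y = dim N = 2`
  have hdimYN : topologicalKrullDim Y = topologicalKrullDim N.left := hr.topologicalKrullDim_eq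
  have hdimY : topologicalKrullDim Y = (d : ℕ) := topologicalKrullDim_eq_of_smoothOfRelativeDimension (r ≫ N.hom) d
  have hd2 : d = 2 := by
    have h1 : ((d : ℕ∞) : WithBot ℕ∞) = ((2 : ℕ) : ℕ∞) := by
      exact hdimY.symm.trans (hdimYN.trans hdimN)
    exact_mod_cast h1
  subst hd2
  have hE : IsSmoothProjective 2 E := ⟨hd, hYproj, hgiY⟩
  -- ### (3) the lift `θ : U ↪ Y` of `ι` (the image of `U` lies in the regular locus, over which `r` is an isomorphism)
  have hVreg : ∀ x ∈ V, IsRegularLocalRing (N.left.presheaf.stalk x) := by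
    rintro _ ⟨u, rfl⟩
    haveI := hUreg u
    exact IsRegularLocalRing.of_ringEquiv (asIso (ι.left.stalkMap u)).commRingCatIsoToRingEquiv.symm
  haveI : IsIso (r ∣_ V) := hreg V hVreg
  let θl : U.left ⟶ Y := ι.left.isoOpensRange.hom ≫ inv (r ∣_ V) ≫ (r ⁻¹ᵁ V).ι
  have hθr : θl ≫ r = ι.left := by
    change (ι.left.isoOpensRange.hom ≫ inv (r ∣_ V) ≫ (r ⁻¹ᵁ V).ι) ≫ r = ι.left
    rw [Category.assoc, Category.assoc, ← morphismRestrict_ι, IsIso.inv_hom_id_assoc, Scheme.Hom.isoOpensRange_hom_ι]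
  have hθw : θl ≫ E.hom = U.hom := by
    change θl ≫ r ≫ N.hom = U.hom
    rw [← Category.assoc, hθr, Over.w ι]
  let θ : U ⟶ E := Over.homMk θl hθw
  haveI : IsOpenImmersion θl := inferInstance
  refine ⟨E, ρY, θ, hE, inferInstanceAs (IsOpenImmersion θl), fun g => ?_⟩
  -- ### (4) equivariance
  change (ρU.aut g).hom ≫ θl = θl ≫ (ρY.aut g).hom
  have hc : ((ρU.aut g).hom ≫ θl) ≫ r = ι.left ≫ (ρN.aut g).hom := by
    rw [Category.assoc, hθr]; exact hιeq g
  have hc' : (θl ≫ (ρY.aut g).hom) ≫ r = ι.left ≫ (ρN.aut g).hom := by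
    rw [Category.assoc, hYeq g, ← Category.assoc, hθr]
  have hrange : ∀ u : U.left, (ι.left ≫ (ρN.aut g).hom) u ∈ V := fun u => by
    rw [← hιeq g, Scheme.Hom.comp_apply]
    exact ⟨_, rfl⟩
  refine eq_of_comp_eq_of_range_subset r V (hc.trans hc'.symm) (fun u => ?_) (fun u => ?_)
  · rw [← Scheme.Hom.comp_apply, hc]; exact hrange u
  · rw [← Scheme.Hom.comp_apply, hc']; exact hrange u

end Literature.AlgebraicGeometry.HodgeTheory.Q8Family

end
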